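import Mathlib.Analysis.SpecialFunctions.Complex.CircleAddChar
import Mathlib.NumberTheory.LegendreSymbol.AddCharacter
import Mathlib.LinearAlgebra.UnitaryGroup
import Mathlib.Analysis.InnerProductSpace.PiL2
import HarnessLib

/-!
# The quantum Fourier transform on `ℤ_Rⁿ` as a unitary matrix

Topic `Computability/QuantumComplexity`. The (ideal) quantum Fourier transform on the finite abelian
group `ℤ_Rⁿ = (ZMod R)^ι` — the unitary which Regev's quantum step (Regev 2009, Lemma 3.14: "We now
apply the quantum Fourier transform on `ℤ_Rⁿ`. We obtain a state in which the amplitude of `|t⟩` for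
`t ∈ ℤ_Rⁿ` is proportional to `∑_s f(s) exp(2πi⟨s,t⟩/R)`") applies to the periodic Gaussian state —
recorded as an explicit matrix over `ℂ` together with the proof that it is unitary (character
orthogonality on `ℤ_Rⁿ`, coordinate by coordinate; Nielsen–Chuang 2010, §5.1, eq. (5.2) and
Ex. 5.1 "the Fourier transform is unitary"). Everything here is PROVED; the object is a `def` with
body (`qftMatrix`), the analysis theorems:

* `qftKernel R s t = ∏ᵢ e_R(sᵢ tᵢ)` with `e_R = ZMod.stdAddChar` (`e_R(j) = exp(2πi j/R)`), i.e.
  `exp(2πi⟨s,t⟩/R)`; `qftKernel_eq_exp` (the closed form through representatives);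
* `sum_qftKernel_mul_conj` — **orthogonality**: `∑_s χ_t(s) conj(χ_{t'}(s)) = Rⁿ [t = t']`;
* `qftMatrix ι R` (entries `R^{-n/2} exp(2πi⟨s,t⟩/R)`), `qftMatrix_mulVec` and
  **`qftMatrix_mem_unitaryGroup`**.

## References

* M. A. Nielsen, I. L. Chuang, *Quantum Computation and Quantum Information*, CUP 2010, §5.1
  (eq. (5.2), Ex. 5.1) [NielsenChuang2010].
* O. Regev, *On lattices, learning with errors, random linear codes, and cryptography*, J. ACM 56
  (2009), Lemma 3.14 (the QFT on `ℤ_Rⁿ`) [Regev2009].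
-/

noncomputable section

open Complex Matrix
open scoped Real ComplexConjugate

namespace Literature.Computability.QuantumComplexity

namespace QFTZMod

variable {ι : Type*} [Fintype ι] (R : ℕ) [NeZero R]

/-! ### The kernel `exp(2πi⟨s,t⟩/R)` -/

/-- **The kernel of the Fourier transform on `ℤ_Rⁿ`**: `χ_t(s) = ∏ᵢ e_R(sᵢ tᵢ) = exp(2πi⟨s,t⟩/R)`.
[cite: NielsenChuang2010, §5.1 eq. (5.2)] -/
def qftKernel (s t : ι → ZMod R) : ℂ := ∏ i, ZMod.stdAddChar (s i * t i)

/-- The kernel is symmetric. [folklore] -/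
theorem qftKernel_comm (s t : ι → ZMod R) : qftKernel R s t = qftKernel R t s := by
  unfold qftKernel; simp_rw [mul_comm]

/-- The kernel has modulus one. [folklore] -/
theorem norm_qftKernel (s t : ι → ZMod R) : ‖qftKernel R s t‖ = 1 := by
  unfold qftKernel
  rw [norm_prod, Finset.prod_eq_one]
  intro i _
  rw [ZMod.stdAddChar_apply, Circle.norm_coe]

/-- `conj χ_t(s) = χ_t(-s)`. [folklore] -/
theorem conj_qftKernel (s t : ι → ZMod R) : conj (qftKernel R s t) = qftKernel R (-s) t := by
  unfold qftKernel
  rw [map_prod]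
  refine Finset.prod_congr rfl fun i _ => ?_
  rw [Pi.neg_apply, neg_mul, AddChar.map_neg_eq_conj]

/-- Additivity in the first variable: `χ_t(s + s') = χ_t(s) χ_t(s')`. [folklore] -/
theorem qftKernel_add (s s' t : ι → ZMod R) : qftKernel R (s + s') t = qftKernel R s t * qftKernel R s' t := by
  unfold qftKernel
  rw [← Finset.prod_mul_distrib]
  refine Finset.prod_congr rfl fun i _ => ?_
  rw [Pi.add_apply, add_mul, AddChar.map_add_eq_mul]

/-- **Closed form through representatives**: `χ_t(s) = exp(2πi (∑ᵢ sᵢ.val tᵢ.val)/R)`. [cite: NielsenChuang2010, §5.1 eq. (5.2)] -/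
theorem qftKernel_eq_exp (s t : ι → ZMod R) :
    qftKernel R s t = Complex.exp (2 * π * I * ((∑ i, ((s i).val * (t i).val : ℕ) : ℤ) : ℂ) / R) := by
  unfold qftKernel
  have h : ∀ i, (ZMod.stdAddChar (s i * t i) : ℂ) = Complex.exp (2 * π * I * (((s i).val * (t i).val : ℕ) : ℤ) / R) := by
    intro i
    rw [← ZMod.stdAddChar_coe]
    congr 1
    push_cast
    rw [ZMod.natCast_zmod_val, ZMod.natCast_zmod_val]
  simp_rw [h]
  rw [← Complex.exp_sum]
  congr 1
  push_cast
  rw [Finset.mul_sum, Finset.sum_div]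

/-! ### Orthogonality -/

variable [DecidableEq ι]

/-- **Orthogonality of the characters of `ℤ_Rⁿ`**: `∑_s χ_t(s) · conj χ_{t'}(s) = Rⁿ` if `t = t'`
and `0` otherwise (coordinatewise `∑_{x ∈ ℤ_R} e_R(x b) = R [b = 0]`, `AddChar.sum_mulShift` for the
primitive character `e_R`). [cite: NielsenChuang2010, §5.1 (Ex. 5.1: the Fourier transform is unitary)] -/
theorem sum_qftKernel_mul_conj (t t' : ι → ZMod R) :
    ∑ s : ι → ZMod R, qftKernel R s t * conj (qftKernel R s t') =
      if t = t' then ((R : ℂ) ^ Fintype.card ι) else 0 := by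
  classical
  -- combine into one product of characters of the differences
  have hcomb : ∀ s : ι → ZMod R, qftKernel R s t * conj (qftKernel R s t') =
      ∏ i, ZMod.stdAddChar (s i * (t i - t' i)) := by
    intro s
    rw [conj_qftKernel]
    unfold qftKernel
    rw [← Finset.prod_mul_distrib]
    refine Finset.prod_congr rfl fun i _ => ?_
    rw [Pi.neg_apply, ← AddChar.map_add_eq_mul]
    congr 1; ring
  simp_rw [hcomb]
  have hps := Finset.prod_univ_sum (fun _ : ι => (Finset.univ : Finset (ZMod R)))
    fun i x => (ZMod.stdAddChar (x * (t i - t' i)) : ℂ)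
  rw [Fintype.piFinset_univ] at hps
  rw [← hps]
  · simp_rw [AddChar.sum_mulShift _ (ZMod.isPrimitive_stdAddChar R), ZMod.card, sub_eq_zero]
    by_cases h : t = t'
    · subst h
      simp
    · rw [if_neg h]
      obtain ⟨i, hi⟩ : ∃ i, t i ≠ t' i := by
        by_contra hall
        push Not at hall
        exact h (funext hall)
      exact Finset.prod_eq_zero (Finset.mem_univ i) (by rw [if_neg hi]; simp)

/-! ### The unitary matrix -/

variable (ι)

/-- **The quantum Fourier transform on `ℤ_Rⁿ`** as a matrix: entry `(t, s)` is
`R^{-n/2} exp(2πi⟨s,t⟩/R)`. [cite: NielsenChuang2010, §5.1 eq. (5.2)] -/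
def qftMatrix : Matrix (ι → ZMod R) (ι → ZMod R) ℂ :=
  fun t s => ((Real.sqrt ((R : ℝ) ^ Fintype.card ι))⁻¹ : ℝ) * qftKernel R s t

variable {ι}

/-- **The QFT acts by the Fourier sum**: `(F ψ)(t) = R^{-n/2} ∑_s ψ(s) exp(2πi⟨s,t⟩/R)`.
[cite: Regev2009, Lemma 3.14 ("the amplitude of |t⟩ is proportional to ∑_s f(s) exp(2πi⟨s,t⟩/R)")] -/
theorem qftMatrix_mulVec (ψ : (ι → ZMod R) → ℂ) (t : ι → ZMod R) :
    (qftMatrix ι R *ᵥ ψ) t = ((Real.sqrt ((R : ℝ) ^ Fintype.card ι))⁻¹ : ℝ) * ∑ s, ψ s * qftKernel R s t := by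
  simp only [Matrix.mulVec, dotProduct, qftMatrix, Finset.mul_sum]
  exact Finset.sum_congr rfl fun s _ => by ring

/-- **The QFT on `ℤ_Rⁿ` is unitary.** [cite: NielsenChuang2010, §5.1 (Ex. 5.1)] -/
theorem qftMatrix_mem_unitaryGroup : qftMatrix ι R ∈ Matrix.unitaryGroup (ι → ZMod R) ℂ := by
  classical
  rw [Matrix.mem_unitaryGroup_iff]
  ext t t'
  rw [Matrix.mul_apply, Matrix.one_apply]
  have hc : (0 : ℝ) < Real.sqrt ((R : ℝ) ^ Fintype.card ι) :=
    Real.sqrt_pos.2 (pow_pos (by exact_mod_cast Nat.pos_of_ne_zero (NeZero.ne R)) _)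
  have hterm : ∀ s, qftMatrix ι R t s * star (qftMatrix ι R t' s) =
      (((Real.sqrt ((R : ℝ) ^ Fintype.card ι))⁻¹ : ℝ) : ℂ) ^ 2 * (qftKernel R s t * conj (qftKernel R s t')) := by
    intro s
    simp only [qftMatrix, RCLike.star_def, map_mul, Complex.conj_ofReal]
    ring
  change ∑ s, qftMatrix ι R t s * star (qftMatrix ι R t' s) = _
  simp_rw [hterm]
  rw [← Finset.mul_sum, sum_qftKernel_mul_conj]
  split_ifs with h
  · rw [← Complex.ofReal_pow, inv_pow, Real.sq_sqrt (by positivity), Complex.ofReal_inv, Complex.ofReal_pow,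
      Complex.ofReal_natCast, inv_mul_cancel₀]
    exact pow_ne_zero _ (by exact_mod_cast NeZero.ne R)
  · rw [mul_zero]

end QFTZMod

end Literature.Computability.QuantumComplexity

end
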